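import Summits.QuantumFields.BalabanUV.Beta.D1BFx.PackedStraightColumnLambdaMass
import Summits.QuantumFields.BalabanUV.Beta.D1BFx.PackedStraightColumnMixedMass
import Summits.QuantumFields.BalabanUV.Beta.CombFormSlotGaugeLetter

/-!
# `BalabanUV.Beta.D1BFx.StraightPinVertexFamilies` — road «BF-x» for binder row D1, slot (K), PART 24 HEAD «TWO PINS» (spec v1.1 §2 (H2-Λ) ∕ (H2-M), §4 (b)), «K0-VF-PACK»:
# **THE STRAIGHT-PIN FIRST-ORDER VERTEX FAMILIES IN `VertexFamily` (sup-entry `BiLoc`) CURRENCY WITH THE POWERS DISPLAYED** — the `hV : VertexFamily V n Cv δv` plug of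
# d1-leaf-01's `ColumnGaugePairContact.vertexFamily₂_Wmix_of_weight ∕ _record` for `V := vertexOfK K₀ n S♭ ∕ S⁰ ∕ SΛ` and `vertexOfM K₀ n M⁰`, hypothesis-free at the record

HONEST DEPENDENCY (cell records, verbatim): «continuum YM on T⁴ ⇐ BetaPertH ∧ nine spine estimates (0/9 proved); BetaPertH ⇐ (D1) ∧ (D4) ∧
CAP+tail; G-an2-4 gates asym, D1 and NE2/3/4.»  HONEST FRAMING (cell contract, verbatim): «discharging `BetaPertH` makes Bałaban's UV stability
UNCONDITIONAL — a real constructive-QFT result; it is NOT the continuum limit and NOT the Clay problem.»  THIS MODULE DISCHARGES NOTHING of the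
wall: [folklore] sup-entry bookkeeping BY NAME over LANDED objects (lit `OneStepResolventKernel.biLoc_wsum`, `InterLevelTransport.biLoc_cwsum ∕ locStencil_SLam`,
`StepJetData.locStencil_wilsonA ∕ _add ∕ _smul`; an1's `SymAveragingHessianCounts.locStencil_symVhSAt ∕ vertexFamily_symHessFFAt`, `SpineRooted.vertexFamily_M1Of`; this
lineage's g60 `PackedStraightColumn.abs_colH_K₀_road_le`, g61 `PackedStraightColumnLambdaMass.abs_lamCoeffOf_KInv_road_le` ∕ `PackedStraightColumnMixedMass.abs_colM_K₀_le_of_wΦ`).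
No definition, no `def … : Prop`, nothing cited, 0 sorry.  Nothing of the tables or of Bałaban's is asserted (`wBound 3`, `ell`, `MG163`, `periodConst`, `Zl` symbolic); NO (1.22)
row is proved; the multiplier envelope is a DISPLAYED hypothesis `hΦ` (the SHAPE of d4-p3's level-uniform `RemainderExplicitMultiplier.exists_wΦ_decay`); 0 root-level binders of row
D1 discharged (hW ∕ hR-sockets ∕ hSX-socket ∕ D1Tel ∕ D1Rep = 0); (J1) ONE OPEN ROW; (K) NOT closed; NOT D1, NEVER «G-an2-4 closed», NOT `BetaPertH`, NOT continuum, NOT Clay.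

ABSOLUTE RULE (cell charter, verbatim): «No internally-minted statement may enter as a cited fact. Every hypothesis is either kernel-proved in
this package or a verbatim quotation of a PUBLISHED theorem with page reference. The manuscript(s) under audit are NOT citable for their own
disputed steps — they are the thing under adjudication; programme-internal (2001/route/tribunal) claims are never citable.»

WHY.  `PART24-HEAD-SPEC-g24.md` v1.1 §4 (b): the HEAD prices the displaced words that do NOT cancel at a pin — `G^{Dsh}`, `W^{Dsh}` (d1-leaf-01 `ColumnGaugeDefectRecord`),
the Λ-sector word `W^{Λ} = −cΛ•Wmix(Λc; V_{SΛ})` and the mixed contacts `W^{M} = Wmix(Λ; V^M)` — and d1-leaf-01's `ColumnGaugePairContact.vertexFamily₂_Wmix_of_weight ∕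
_record` turns `Wmix(Λ; V)` into a second-order vertex family from ONE input `hV : VertexFamily V n Cv δv` for the first-order family `V` («the HEAD plugs `V := vertexOfK K₀ n S♭ ∕
S⁰ ∕ SΛ`, `vertexOfM K₀ n M⁰` with `vertexFamily_vertexOfK`-class letters»); the `G^{Dsh}` bubble cross words of (H3-Δ) need the same `hV` for `V^s = vertexOfK K₀ n S⁰`
(`ExpKernelCalculus.decay510_hessKer`-class bounds).  In the tree those letters exist at the straight pin ONLY EXISTENTIALLY (`OneStepKernelFamily.vertexFamily_vertexOfK'` over
`decays_KInvStep`, `RawStencilSupportRows.locStencil_JsB12CombSh0_S_zero_of_decays`: `∃ C δ`) — a price needs them DISPLAYED.  This file writes them with every constant and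
rate in place: the column envelope replaces `Decays K` (so the straight `ℋ`-column's `(n⁵)⁻¹` and the multiplier column's `(n⁵)⁻¹·(n³)⁻¹` are visible), and the record's sectors are
fed by the every-rate letters of lit ∕ an1 ∕ this lineage — HYPOTHESIS-FREE for the field sectors, modulo the displayed `hΦ` for `V^M`.

CONTENT (`K₀ := KInvStep 3 n 0`, `ρ_c := ctr 4 n`, `C₄ := MG163 4·periodConst (kappa163 4) 3`, `κ′ := kappa163 4 ∕ 4`, `CΛ₀ :=` g61 D′'s displayed constant).
* §1 K-GENERIC, any `d`: **`vertexFamily_vertexOfK_of_colH`** (column envelope `|colH K N μ y κ u| ≤ C_K·e^{−δ_K|u − N•y|₁}` + `LocStencil S Cs δ`, `δ ≤ δ_K` ⟹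
  `VertexFamily (vertexOfK K N S) N ((d+1)·(C_K·Cs·Zl (d+1) (δ∕2))) (δ∕2)`), **`vertexFamily_vertexOfM_of_colM`** (`|colM K N μ y ρ w| ≤ C_M·e^{−δ|N•w − N•y|₁}` +
  `VertexFamily M N Cq δ` ⟹ `VertexFamily (vertexOfM K N M) N ((d+1)·(C_M·Cq·Zl (d+1) (δ∕2))) (δ∕2)`).
* §2 AT `K₀`: **`vertexFamily_vertexOfK_K₀`** (`C_K = (n⁵)⁻¹·C₄e^{κ′}`, `δ ≤ κ′∕(4n)`), **`vertexFamily_vertexOfM_K₀_of_wΦ`** (`C_M = CΦ·(n⁵)⁻¹·(n³)⁻¹·e^{κ₀}`, `δ ≤ κ₀∕(4n)`).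
* §3 THE RECORD's FIELD SECTORS, HYPOTHESIS-FREE: **`locStencil_Sflat_record`** (`S♭ = n⁴•wilsonA + (−n⁸∕2)•symVhSAt ρ_c`, every `δ ≥ 0`), **`locStencil_SLam_road`** (any
  `VertexFamily H n C_H δ`; the one-shot coefficients re-centred from `n•blk n u` to `u` at the cost `e^{κ′}`), **`locStencil_SLam_record`**, **`locStencil_S_zero_record`** (the
  literal's `S⁰` by `JsB12CombSh0_S_zero`); **`vertexFamily_vertexOfK_K₀_Sflat_record`**, **`_SLam_record`**, **`_S_zero_record`**.
* §4 THE RECORD's MULTIPLIER TABLE: **`vertexFamily_vertexOfM_K₀_M1Of_record`** (`(symTablesAn1S2 3 n cΛ).M j = M1Of 3 n (symHessFFAt ρ_c n) cΛ j`, modulo `hΦ`).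
NOT HERE (honest): any (1.22) row; the `Wmix` step itself (d1-leaf-01's, BY NAME at the consumer); R-T's MASS-currency rows (this lineage's g60∕g61 packs); whether the displayed
constants (`Zl 4 (δ∕2) ≍ n⁴` at `δ ≍ 1∕n`, an1's `ell(4,n)² ≍ n²`) make a row n-free — the theorems display them and assert nothing about their use.
Unit `b2b-balaban-gan24-formalise-leaf-05` (gen 62), G-an2-4 swarm leaf prover 05, road «BF-x» supplier; INTENT-1 «K0-VF-PACK» (journal [GAN24LEAF05-G62-INTENT-1]).  No existing file touched.
-/

noncomputable section

open Finset
open scoped BigOperators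
open Literature.MathematicalPhysics.QuantumFieldTheory
open Literature.MathematicalPhysics.QuantumFieldTheory.Balaban1983to89
open Literature.MathematicalPhysics.QuantumFieldTheory.Balaban1983to89.Beta
open B12Sec2to5 (l1 l1_nonneg)
open B4ContourShift (supNorm)
open B5Hk163Strip (kappa163 kappa163_pos)
open B5Hk163Decay (MG163)
open B4TorusKernel (periodConst)
open ExpKernelCalculus (Site MKer Zl Zl_pos Zl_nonneg BiLoc VertexFamily l1_sub_triangle l1_sub_symm)
open AffineAveraging (box toSite)
open AveragingContours (off off_mem_box blk_add_off)
open AveragingContoursRooted (ctr ctrOff ctrOff_mem_box)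
open AveragingHessianKernels (ell)
open KernelSpecInstance (wΦ)
open OneStepResolventKernel (Fib wsum KInv LocStencil biLoc_wsum bound_mono)
open OneStepKernelFamily (colH KInvStep vertexOfK)
open InterLevelTransport (cwsum SLam biLoc_cwsum locStencil_SLam)
open SecondOrderResponse (colM vertexOfM)
open StepJetData (wilsonA wBound wBound_nonneg locStencil_wilsonA locStencil_add locStencil_smul)
open BalabanStepJets (lamCoeffOf)
open Summit.QuantumFields.BalabanUV.Beta.SymAveragingHessianCounts (symVhSAt symHessFFAt locStencil_symVhSAt vertexFamily_symHessFFAt)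
open BalabanStepW2 (wM1)
open Summit.QuantumFields.BalabanUV.Beta.SpineRooted (M1Of vertexFamily_M1Of)
open Summit.QuantumFields.BalabanUV.Beta.SymSecondOrderTablesAn1 (symTablesAn1S2)
open Summit.QuantumFields.BalabanUV.Beta.CombChartStepJets (JsB12CombSh0)
open Summit.QuantumFields.BalabanUV.Beta.CombFormSlotGaugeLetter (JsB12CombSh0_S_zero)
open Summit.QuantumFields.BalabanUV.Beta.D1BFx.PackedStraightColumn (abs_colH_K₀_road_le)
open Summit.QuantumFields.BalabanUV.Beta.D1BFx.PackedColumnBlockTotalMass (l1_toSite_le_of_mem_box)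
open Summit.QuantumFields.BalabanUV.Beta.D1BFx.PackedStraightColumnLambdaMass (abs_lamCoeffOf_KInv_road_le)
open Summit.QuantumFields.BalabanUV.Beta.D1BFx.PackedStraightColumnMixedMass (abs_colM_K₀_le_of_wΦ)

namespace Summit.QuantumFields.BalabanUV.Beta.D1BFx.StraightPinVertexFamilies

/-! ## §1 K-generic: vertex families from DISPLAYED column envelopes -/

section Generic

variable {d N : ℕ}

/-- [folklore] **THE CHAIN-RULE VERTEX IS A VERTEX FAMILY, COLUMN ENVELOPE DISPLAYED** (lit `OneStepKernelFamily.vertexFamily_vertexOfK` with `Decays K C δ_K` replaced by the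
`ℋ`-column's own envelope — the straight pin's `(n⁵)⁻¹` lives there, not in `Decays K₀`): if `|colH K N μ y κ u| ≤ C_K·e^{−δ_K|u − N•y|₁}` and `S` is a local stencil family
(`LocStencil S Cs δ`, `0 < δ ≤ δ_K`), then `VertexFamily (vertexOfK K N S) N ((d+1)·(C_K·Cs·Zl (d+1) (δ∕2))) (δ∕2)` — `biLoc_wsum` per `κ′`, then the finite `κ′`-sum. -/
theorem vertexFamily_vertexOfK_of_colH {K : MKer (d + 1) (Fib d)} {CK δK : ℝ}
    (hcol : ∀ (μ : Fin (d + 1)) (y : Fin (d + 1) → ℤ) (κ' : Fin (d + 1)) (u : Fin (d + 1) → ℤ),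
      |colH K N μ y κ' u| ≤ CK * Real.exp (-δK * l1 (u - (N : ℤ) • y)))
    (hCK : 0 ≤ CK) {S : Fin (d + 1) → (Fin (d + 1) → ℤ) → MKer (d + 1) (Fib d)} {Cs δ : ℝ} (hS : LocStencil S Cs δ) (hδ : 0 < δ)
    (hδK : δ ≤ δK) :
    VertexFamily (vertexOfK K N S) N ((d + 1 : ℕ) * (CK * Cs * Zl (d + 1) (δ / 2))) (δ / 2) := by
  intro μ y
  have hterm : ∀ κ' : Fin (d + 1), BiLoc (wsum (colH K N μ y κ') (S κ')) ((N : ℤ) • y) ((N : ℤ) • y) (CK * Cs * Zl (d + 1) (δ / 2)) (δ / 2) :=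
    fun κ' => biLoc_wsum (fun u => bound_mono (hcol μ y κ' u) hCK le_rfl hδK (l1_nonneg _)) (fun u => hS κ' u) hδ hCK
  have hsum := OneStepResolventKernel.biLoc_finset_sum (Finset.univ : Finset (Fin (d + 1))) (fun κ' _ => hterm κ')
  simp only [Finset.sum_const, Finset.card_univ, Fintype.card_fin, nsmul_eq_mul] at hsum
  exact hsum

/-- [folklore] **THE MULTIPLIER-COLUMN VERTEX IS A VERTEX FAMILY, COLUMN ENVELOPE DISPLAYED** (lit `SecondOrderResponse.vertexFamily_vertexOfM` with `Decays K` replaced by the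
multiplier column's own envelope): if `|colM K N μ y ρ w| ≤ C_M·e^{−δ|N•w − N•y|₁}` (fine units, coarse slots) and `VertexFamily M N Cq δ`, `0 < δ`, then
`VertexFamily (vertexOfM K N M) N ((d+1)·(C_M·Cq·Zl (d+1) (δ∕2))) (δ∕2)` — lit `InterLevelTransport.biLoc_cwsum` per `ρ`, then the finite `ρ`-sum. -/
theorem vertexFamily_vertexOfM_of_colM [NeZero N] {K : MKer (d + 1) (Fib d)} {CM δ : ℝ}
    (hcol : ∀ (μ : Fin (d + 1)) (y : Fin (d + 1) → ℤ) (ρ : Fin (d + 1)) (w : Fin (d + 1) → ℤ),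
      |colM K N μ y ρ w| ≤ CM * Real.exp (-δ * l1 ((N : ℤ) • w - (N : ℤ) • y)))
    (hCM : 0 ≤ CM) {M : Fin (d + 1) → (Fin (d + 1) → ℤ) → MKer (d + 1) (Fib d)} {Cq : ℝ} (hM : VertexFamily M N Cq δ) (hδ : 0 < δ) :
    VertexFamily (vertexOfM K N M) N ((d + 1 : ℕ) * (CM * Cq * Zl (d + 1) (δ / 2))) (δ / 2) := by
  intro μ y
  have hterm : ∀ ρ : Fin (d + 1), BiLoc (cwsum N (colM K N μ y ρ) (M ρ)) ((N : ℤ) • y) ((N : ℤ) • y) (CM * Cq * Zl (d + 1) (δ / 2)) (δ / 2) :=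
    fun ρ => biLoc_cwsum (fun w => hcol μ y ρ w) (fun w => hM ρ w) hδ hCM
  have hsum := OneStepResolventKernel.biLoc_finset_sum (Finset.univ : Finset (Fin (d + 1))) (fun ρ _ => hterm ρ)
  simp only [Finset.sum_const, Finset.card_univ, Fintype.card_fin, nsmul_eq_mul] at hsum
  exact hsum

end Generic

/-! ## §2 At the straight pin `K₀ = KInvStep 3 n 0`: the column powers displayed -/

section Straight

variable (n : ℕ) [NeZero n]

/-- [folklore] **A STRAIGHT-PIN FIRST-JET FAMILY IS A VERTEX FAMILY, THE COLUMN's `(n⁵)⁻¹` DISPLAYED**: for every local stencil family `S` (`LocStencil S Cs δ`) at a rate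
`0 < δ ≤ κ′∕(4n)` (the straight column's fine rate, g60 FILE A `abs_colH_K₀_road_le`: `|colH K₀ n μ y κ u| ≤ ((n⁵)⁻¹·C₄e^{κ′})·e^{−(κ′∕(4n))|u − n•y|₁}`, UNCONDITIONAL),
`VertexFamily (vertexOfK K₀ n S) n (4·(((n⁵)⁻¹·C₄e^{κ′})·Cs·Zl 4 (δ∕2))) (δ∕2)`. -/
theorem vertexFamily_vertexOfK_K₀ {S : Fin (3 + 1) → (Fin (3 + 1) → ℤ) → MKer 4 (Fib 3)} {Cs δ : ℝ} (hS : LocStencil S Cs δ) (hδ : 0 < δ)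
    (hδK : δ ≤ kappa163 4 / 4 / (4 * (n : ℝ))) :
    VertexFamily (vertexOfK (KInvStep (d := 3) n 0) n S) n
      (4 * ((((n : ℝ) ^ 5)⁻¹ * ((MG163 4 * periodConst (kappa163 4) 3) * Real.exp (kappa163 4 / 4))) * Cs * Zl 4 (δ / 2))) (δ / 2) := by
  have hC : 0 ≤ ((n : ℝ) ^ 5)⁻¹ * ((MG163 4 * periodConst (kappa163 4) 3) * Real.exp (kappa163 4 / 4)) := by
    have h0 := (abs_nonneg _).trans (abs_colH_K₀_road_le n 0 0 0 0)
    exact (mul_nonneg_iff_of_pos_right (Real.exp_pos _)).1 h0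
  have h := vertexFamily_vertexOfK_of_colH (N := n) (K := KInvStep (d := 3) n 0) (fun μ y κ' u => abs_colH_K₀_road_le n μ y κ' u) hC hS hδ hδK
  have e4 : ((3 + 1 : ℕ) : ℝ) = 4 := by norm_num
  rw [e4] at h
  exact h

/-- [folklore] **THE STRAIGHT-PIN MULTIPLIER-COLUMN VERTEX IS A VERTEX FAMILY, `(n⁵)⁻¹·(n³)⁻¹` DISPLAYED** (modulo the displayed block-scale envelope `hΦ` of the
multiplier-response kernel, `0 < κ₀` — the SHAPE of d4-p3's level-uniform `RemainderExplicitMultiplier.exists_wΦ_decay`; g61 C′ `abs_colM_K₀_le_of_wΦ`): for every vertex family of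
multiplier tables `VertexFamily M n Cq δ` at a rate `0 < δ ≤ κ₀∕(4n)`, `VertexFamily (vertexOfM K₀ n M) n (4·((CΦ·(n⁵)⁻¹·(n³)⁻¹·e^{κ₀})·Cq·Zl 4 (δ∕2))) (δ∕2)`. -/
theorem vertexFamily_vertexOfM_K₀_of_wΦ {CΦ κ₀ : ℝ} (hκ₀ : 0 < κ₀)
    (hΦ : ∀ (ρ ν : Fin (3 + 1)) (w : Fin (3 + 1) → ℤ),
      |wΦ (N := n) ρ ν w| ≤ CΦ * ((n : ℝ) ^ 5)⁻¹ * ((n : ℝ) ^ 3)⁻¹ * Real.exp (-(κ₀ * supNorm w)))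
    {M : Fin (3 + 1) → (Fin (3 + 1) → ℤ) → MKer 4 (Fib 3)} {Cq δ : ℝ} (hM : VertexFamily M n Cq δ) (hδ : 0 < δ) (hδ₀ : δ ≤ κ₀ / (4 * (n : ℝ))) :
    VertexFamily (vertexOfM (KInvStep (d := 3) n 0) n M) n
      (4 * ((CΦ * ((n : ℝ) ^ 5)⁻¹ * ((n : ℝ) ^ 3)⁻¹ * Real.exp κ₀) * Cq * Zl 4 (δ / 2))) (δ / 2) := by
  have hcol := abs_colM_K₀_le_of_wΦ n hκ₀.le hΦ
  have hC : 0 ≤ CΦ * ((n : ℝ) ^ 5)⁻¹ * ((n : ℝ) ^ 3)⁻¹ * Real.exp κ₀ := by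
    have h0 := (abs_nonneg _).trans (hcol 0 0 0 0)
    exact (mul_nonneg_iff_of_pos_right (Real.exp_pos _)).1 h0
  have hcol' : ∀ (μ : Fin (3 + 1)) (y : Fin (3 + 1) → ℤ) (ρ : Fin (3 + 1)) (w : Fin (3 + 1) → ℤ),
      |colM (KInvStep (d := 3) n 0) n μ y ρ w| ≤ (CΦ * ((n : ℝ) ^ 5)⁻¹ * ((n : ℝ) ^ 3)⁻¹ * Real.exp κ₀) * Real.exp (-δ * l1 ((n : ℤ) • w - (n : ℤ) • y)) :=
    fun μ y ρ w => bound_mono (hcol μ y ρ w) hC le_rfl hδ₀ (l1_nonneg _)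
  have h := vertexFamily_vertexOfM_of_colM (N := n) (K := KInvStep (d := 3) n 0) hcol' hC hM hδ
  have e4 : ((3 + 1 : ℕ) : ℝ) = 4 := by norm_num
  rw [e4] at h
  exact h

/-! ## §3 The record's field sectors, hypothesis-free -/

/-- [folklore] **THE RECORD's PURE PART `S♭ = n⁴•wilsonA + (−n⁸∕2)•symVhSAt ρ_c` IS A LOCAL STENCIL FAMILY AT EVERY RATE, CONSTANT DISPLAYED**: for every `δ ≥ 0`,
`LocStencil S♭ (n⁴·(wBound 3·e^{4δ}) + (n⁸∕2)·(3·ell(4,n)²·e^{16nδ})) δ` — lit `locStencil_wilsonA` and an1's `locStencil_symVhSAt` at the centred root BY NAME. -/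
theorem locStencil_Sflat_record {δ : ℝ} (hδ : 0 ≤ δ) :
    LocStencil (fun κ u => ((n : ℝ) ^ 4) • wilsonA 3 κ u + (-((n : ℝ) ^ 8 / 2)) • symVhSAt (ctr 4 n) 3 n rfl κ u)
      ((n : ℝ) ^ 4 * (wBound 3 * Real.exp (4 * δ))
        + (n : ℝ) ^ 8 / 2 * (3 * (ell (3 + 1) n : ℝ) ^ 2 * Real.exp (4 * ((3 : ℝ) + 1) * n * δ))) δ := by
  have hn1 : 1 ≤ n := Nat.one_le_iff_ne_zero.2 (NeZero.ne n)
  have h1 : LocStencil (wilsonA 3) (wBound 3 * Real.exp (4 * δ)) δ := locStencil_wilsonA hδ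
  have h2 : LocStencil (symVhSAt (ctr 4 n) 3 n rfl) (3 * (ell (3 + 1) n : ℝ) ^ 2 * Real.exp (4 * ((3 : ℝ) + 1) * n * δ)) δ :=
    locStencil_symVhSAt (d := 3) hn1 (ctrOff_mem_box hn1) hδ
  have h := locStencil_add (locStencil_smul ((n : ℝ) ^ 4) h1) (locStencil_smul (-((n : ℝ) ^ 8 / 2)) h2)
  have e1 : |((n : ℝ) ^ 4)| = (n : ℝ) ^ 4 := abs_of_nonneg (by positivity)
  have e2 : |(-((n : ℝ) ^ 8 / 2))| = (n : ℝ) ^ 8 / 2 := by rw [abs_neg]; exact abs_of_nonneg (by positivity)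
  rw [e1, e2] at h
  exact h

/-- [folklore] **THE ROAD's Λ-SECTOR STENCIL IS A LOCAL STENCIL FAMILY, THE ONE-SHOT COEFFICIENTS' `(n⁵)⁻¹` DISPLAYED** (any Hessian-table letter `VertexFamily H n C_H δ`,
`0 < δ ≤ κ′∕(4n)`): `LocStencil (SLam n (lamCoeffOf (KInv n) n) H) (4·((((n⁵)⁻¹·CΛ₀)·e^{κ′})·C_H·Zl 4 (δ∕2))) (δ∕2)` — g61 D′'s UNCONDITIONAL road envelope
`|lamCoeffOf (KInv n) n μ y κ′ u| ≤ ((n⁵)⁻¹·CΛ₀)·e^{−(κ′∕(4n))|n•y − n•blk n u|₁}` re-centred at `u` (`|n•blk n u − u|₁ ≤ 4n` costs `e^{4nδ} ≤ e^{κ′}`) and fed, with `H`'s letter, to lit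
`InterLevelTransport.locStencil_SLam`. -/
theorem locStencil_SLam_road {H : Fin (3 + 1) → (Fin (3 + 1) → ℤ) → MKer 4 (Fib 3)} {CH δ : ℝ} (hH : VertexFamily H n CH δ) (hδ : 0 < δ)
    (hδK : δ ≤ kappa163 4 / 4 / (4 * (n : ℝ))) :
    LocStencil (SLam n (lamCoeffOf (KInv (N := n)) n) H)
      (((3 + 1 : ℕ) : ℝ) * (((((n : ℝ) ^ 5)⁻¹ * ((3 : ℝ) ^ (3 + 1) * ((3 + 1 : ℕ) : ℝ) * (16 * ((3 + 1 : ℕ) : ℝ)) * (MG163 4 * periodConst (kappa163 4) 3)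
            * Real.exp (kappa163 4 / 4) * Real.exp (kappa163 4 / 4) * Real.exp (kappa163 4 / 4))) * Real.exp (kappa163 4 / 4)) * CH * Zl (3 + 1) (δ / 2))) (δ / 2) := by
  have hn1 : 1 ≤ n := Nat.one_le_iff_ne_zero.2 (NeZero.ne n)
  have hn0 : (0 : ℝ) < (n : ℝ) := by exact_mod_cast Nat.pos_of_ne_zero (NeZero.ne n)
  set C₀ : ℝ := ((n : ℝ) ^ 5)⁻¹ * ((3 : ℝ) ^ (3 + 1) * ((3 + 1 : ℕ) : ℝ) * (16 * ((3 + 1 : ℕ) : ℝ)) * (MG163 4 * periodConst (kappa163 4) 3)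
      * Real.exp (kappa163 4 / 4) * Real.exp (kappa163 4 / 4) * Real.exp (kappa163 4 / 4)) with hC₀def
  have hC₀ : 0 ≤ C₀ := by
    have h0 := (abs_nonneg _).trans (abs_lamCoeffOf_KInv_road_le n 0 0 0 0)
    exact (mul_nonneg_iff_of_pos_right (Real.exp_pos _)).1 h0
  -- the coefficients re-centred from `n•blk n u` to `u`
  have hc : ∀ (μ : Fin (3 + 1)) (y : Fin (3 + 1) → ℤ) (κ' : Fin (3 + 1)) (u : Fin (3 + 1) → ℤ),
      |lamCoeffOf (KInv (N := n)) n μ y κ' u| ≤ (C₀ * Real.exp (kappa163 4 / 4)) * Real.exp (-δ * l1 ((n : ℤ) • y - u)) := by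
    intro μ y κ' u
    have h := abs_lamCoeffOf_KInv_road_le n μ y κ' u
    rw [← hC₀def] at h
    -- weaken the rate to `δ`
    have h1 : |lamCoeffOf (KInv (N := n)) n μ y κ' u| ≤ C₀ * Real.exp (-δ * l1 ((n : ℤ) • y - (n : ℤ) • AveragingContours.blk n u)) :=
      bound_mono h hC₀ le_rfl hδK (l1_nonneg _)
    -- the in-block offset: `u = n•blk n u + toSite (off n u)`, `|toSite (off n u)|₁ ≤ 4n`
    have hoff : l1 ((n : ℤ) • y - u) ≤ l1 ((n : ℤ) • y - (n : ℤ) • AveragingContours.blk n u) + 4 * (n : ℝ) := by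
      have e : (n : ℤ) • AveragingContours.blk n u + toSite (off n u) = u := blk_add_off hn1 u
      have t := l1_sub_triangle ((n : ℤ) • y) ((n : ℤ) • AveragingContours.blk n u) u
      have hres : l1 ((n : ℤ) • AveragingContours.blk n u - u) ≤ 4 * (n : ℝ) := by
        have e2 : u - (n : ℤ) • AveragingContours.blk n u = toSite (off n u) := by
          calc u - (n : ℤ) • AveragingContours.blk n u
              = ((n : ℤ) • AveragingContours.blk n u + toSite (off n u)) - (n : ℤ) • AveragingContours.blk n u := by rw [e]
            _ = toSite (off n u) := by abel
        rw [l1_sub_symm, e2]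
        refine (l1_toSite_le_of_mem_box (off_mem_box hn1 u)).trans (le_of_eq ?_)
        push_cast
        ring
      linarith
    have hexp : Real.exp (-δ * l1 ((n : ℤ) • y - (n : ℤ) • AveragingContours.blk n u))
        ≤ Real.exp (kappa163 4 / 4) * Real.exp (-δ * l1 ((n : ℤ) • y - u)) := by
      rw [← Real.exp_add]
      refine Real.exp_le_exp.2 ?_
      have hδ4 : δ * (4 * (n : ℝ)) ≤ kappa163 4 / 4 := by
        have := mul_le_mul_of_nonneg_right hδK (by positivity : (0 : ℝ) ≤ 4 * (n : ℝ))
        rwa [div_mul_cancel₀ _ (by positivity : (4 * (n : ℝ)) ≠ 0)] at this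
      nlinarith [hoff, hδ.le]
    calc |lamCoeffOf (KInv (N := n)) n μ y κ' u|
        ≤ C₀ * Real.exp (-δ * l1 ((n : ℤ) • y - (n : ℤ) • AveragingContours.blk n u)) := h1
      _ ≤ C₀ * (Real.exp (kappa163 4 / 4) * Real.exp (-δ * l1 ((n : ℤ) • y - u))) := mul_le_mul_of_nonneg_left hexp hC₀
      _ = (C₀ * Real.exp (kappa163 4 / 4)) * Real.exp (-δ * l1 ((n : ℤ) • y - u)) := by ring
  exact locStencil_SLam (N := n) hc hH hδ (mul_nonneg hC₀ (Real.exp_pos _).le)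

/-- [folklore] **THE RECORD's Λ-SECTOR STENCIL `SLam n (lamCoeffOf (KInv n) n) (symHessFFAt ρ_c n)` IS A LOCAL STENCIL FAMILY, HYPOTHESIS-FREE, CONSTANT DISPLAYED**
(`0 < δ ≤ κ′∕(4n)`): §3 `locStencil_SLam_road` fed an1's (LH) `vertexFamily_symHessFFAt` at the centred root (`C_H = 2·ell(4,n)²·e^{16nδ}`). -/
theorem locStencil_SLam_record {δ : ℝ} (hδ : 0 < δ) (hδK : δ ≤ kappa163 4 / 4 / (4 * (n : ℝ))) :
    LocStencil (SLam n (lamCoeffOf (KInv (N := n)) n) (symHessFFAt (ctr 4 n) n))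
      (((3 + 1 : ℕ) : ℝ) * (((((n : ℝ) ^ 5)⁻¹ * ((3 : ℝ) ^ (3 + 1) * ((3 + 1 : ℕ) : ℝ) * (16 * ((3 + 1 : ℕ) : ℝ)) * (MG163 4 * periodConst (kappa163 4) 3)
            * Real.exp (kappa163 4 / 4) * Real.exp (kappa163 4 / 4) * Real.exp (kappa163 4 / 4))) * Real.exp (kappa163 4 / 4))
          * (2 * (ell (3 + 1) n : ℝ) ^ 2 * Real.exp (4 * ((3 : ℝ) + 1) * n * δ)) * Zl (3 + 1) (δ / 2))) (δ / 2) := by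
  have hn1 : 1 ≤ n := Nat.one_le_iff_ne_zero.2 (NeZero.ne n)
  exact locStencil_SLam_road n (vertexFamily_symHessFFAt (d := 3) hn1 (ctrOff_mem_box hn1) hδ.le) hδ hδK

/-- [folklore] **THE LITERAL's LEVEL-0 FIRST-JET PACK `S⁰` IS A LOCAL STENCIL FAMILY, HYPOTHESIS-FREE, CONSTANT DISPLAYED** (`S⁰ = n⁴•wilsonA + (−n⁸∕2)•tabs.V + cΛ•SLam n
(lamCoeffOf (KInv n) n) tabs.H`, `CombFormSlotGaugeLetter.JsB12CombSh0_S_zero`, at an1's record `tabs = symTablesAn1S2 3 n cM`; `0 < δ ≤ κ′∕(4n)`): rate `δ∕2`, constant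
`= (S♭'s at δ∕2) + |cΛ|·(Λ's)`. -/
theorem locStencil_S_zero_record (hodd : Odd n) (N : ℕ) (cM cΛ cB : ℝ) {δ : ℝ} (hδ : 0 < δ) (hδK : δ ≤ kappa163 4 / 4 / (4 * (n : ℝ))) :
    LocStencil (JsB12CombSh0 hodd N (symTablesAn1S2 3 n cM) cΛ cB 0).S
      (((n : ℝ) ^ 4 * (wBound 3 * Real.exp (4 * (δ / 2)))
          + (n : ℝ) ^ 8 / 2 * (3 * (ell (3 + 1) n : ℝ) ^ 2 * Real.exp (4 * ((3 : ℝ) + 1) * n * (δ / 2))))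
        + |cΛ| * (((3 + 1 : ℕ) : ℝ) * (((((n : ℝ) ^ 5)⁻¹ * ((3 : ℝ) ^ (3 + 1) * ((3 + 1 : ℕ) : ℝ) * (16 * ((3 + 1 : ℕ) : ℝ)) * (MG163 4 * periodConst (kappa163 4) 3)
            * Real.exp (kappa163 4 / 4) * Real.exp (kappa163 4 / 4) * Real.exp (kappa163 4 / 4))) * Real.exp (kappa163 4 / 4))
          * (2 * (ell (3 + 1) n : ℝ) ^ 2 * Real.exp (4 * ((3 : ℝ) + 1) * n * δ)) * Zl (3 + 1) (δ / 2)))) (δ / 2) := by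
  rw [JsB12CombSh0_S_zero]
  have h1 := locStencil_Sflat_record n (half_pos hδ).le
  have h2 := locStencil_smul cΛ (locStencil_SLam_record n hδ hδK)
  exact locStencil_add h1 h2

/-- [folklore] **`V_{S♭} := vertexOfK K₀ n S♭` IS A VERTEX FAMILY, HYPOTHESIS-FREE, CONSTANT DISPLAYED** (`0 < δ ≤ κ′∕(4n)`; §2 over §3 `locStencil_Sflat_record`):
`VertexFamily V_{S♭} n (4·(((n⁵)⁻¹·C₄e^{κ′})·(n⁴·wBound 3·e^{4δ} + (n⁸∕2)·3·ell(4,n)²·e^{16nδ})·Zl 4 (δ∕2))) (δ∕2)` — the `hV` plug of d1-leaf-01's `vertexFamily₂_Wmix_of_weight`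
for the road pin's `Wmix(Λc; V_{S♭})`. -/
theorem vertexFamily_vertexOfK_K₀_Sflat_record {δ : ℝ} (hδ : 0 < δ) (hδK : δ ≤ kappa163 4 / 4 / (4 * (n : ℝ))) :
    VertexFamily (vertexOfK (KInvStep (d := 3) n 0) n
        (fun κ u => ((n : ℝ) ^ 4) • wilsonA 3 κ u + (-((n : ℝ) ^ 8 / 2)) • symVhSAt (ctr 4 n) 3 n rfl κ u)) n
      (4 * ((((n : ℝ) ^ 5)⁻¹ * ((MG163 4 * periodConst (kappa163 4) 3) * Real.exp (kappa163 4 / 4)))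
        * ((n : ℝ) ^ 4 * (wBound 3 * Real.exp (4 * δ))
            + (n : ℝ) ^ 8 / 2 * (3 * (ell (3 + 1) n : ℝ) ^ 2 * Real.exp (4 * ((3 : ℝ) + 1) * n * δ)))
        * Zl 4 (δ / 2))) (δ / 2) :=
  vertexFamily_vertexOfK_K₀ n (locStencil_Sflat_record n hδ.le) hδ hδK

/-- [folklore] **`V_{SΛ} := vertexOfK K₀ n (SLam n (lamCoeffOf (KInv n) n) H)` IS A VERTEX FAMILY, BOTH `(n⁵)⁻¹` DISPLAYED** (any Hessian-table letter `VertexFamily H n C_H δ`,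
`0 < δ ≤ κ′∕(4n)`; §2 over §3 `locStencil_SLam_road` at rate `δ∕2`): rate `δ∕4`. -/
theorem vertexFamily_vertexOfK_K₀_SLam {H : Fin (3 + 1) → (Fin (3 + 1) → ℤ) → MKer 4 (Fib 3)} {CH δ : ℝ} (hH : VertexFamily H n CH δ) (hδ : 0 < δ)
    (hδK : δ ≤ kappa163 4 / 4 / (4 * (n : ℝ))) :
    VertexFamily (vertexOfK (KInvStep (d := 3) n 0) n (SLam n (lamCoeffOf (KInv (N := n)) n) H)) n
      (4 * ((((n : ℝ) ^ 5)⁻¹ * ((MG163 4 * periodConst (kappa163 4) 3) * Real.exp (kappa163 4 / 4)))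
        * (((3 + 1 : ℕ) : ℝ) * (((((n : ℝ) ^ 5)⁻¹ * ((3 : ℝ) ^ (3 + 1) * ((3 + 1 : ℕ) : ℝ) * (16 * ((3 + 1 : ℕ) : ℝ)) * (MG163 4 * periodConst (kappa163 4) 3)
            * Real.exp (kappa163 4 / 4) * Real.exp (kappa163 4 / 4) * Real.exp (kappa163 4 / 4))) * Real.exp (kappa163 4 / 4)) * CH * Zl (3 + 1) (δ / 2)))
        * Zl 4 (δ / 2 / 2))) (δ / 2 / 2) :=
  vertexFamily_vertexOfK_K₀ n (locStencil_SLam_road n hH hδ hδK) (half_pos hδ) ((half_le_self hδ.le).trans hδK)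

/-- [folklore] **THE RECORD's `V_{SΛ}` (`H = symHessFFAt ρ_c n`) IS A VERTEX FAMILY, HYPOTHESIS-FREE, CONSTANT DISPLAYED** (`0 < δ ≤ κ′∕(4n)`; an1's (LH) letter BY NAME):
rate `δ∕4` — the `hV` plug for the HEAD's `W^{Λ} = −cΛ•Wmix(Λc; V_{SΛ})` (spec v1.1 §2 (H2-Λ)). -/
theorem vertexFamily_vertexOfK_K₀_SLam_record {δ : ℝ} (hδ : 0 < δ) (hδK : δ ≤ kappa163 4 / 4 / (4 * (n : ℝ))) :
    VertexFamily (vertexOfK (KInvStep (d := 3) n 0) n (SLam n (lamCoeffOf (KInv (N := n)) n) (symHessFFAt (ctr 4 n) n))) n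
      (4 * ((((n : ℝ) ^ 5)⁻¹ * ((MG163 4 * periodConst (kappa163 4) 3) * Real.exp (kappa163 4 / 4)))
        * (((3 + 1 : ℕ) : ℝ) * (((((n : ℝ) ^ 5)⁻¹ * ((3 : ℝ) ^ (3 + 1) * ((3 + 1 : ℕ) : ℝ) * (16 * ((3 + 1 : ℕ) : ℝ)) * (MG163 4 * periodConst (kappa163 4) 3)
            * Real.exp (kappa163 4 / 4) * Real.exp (kappa163 4 / 4) * Real.exp (kappa163 4 / 4))) * Real.exp (kappa163 4 / 4))
          * (2 * (ell (3 + 1) n : ℝ) ^ 2 * Real.exp (4 * ((3 : ℝ) + 1) * n * δ)) * Zl (3 + 1) (δ / 2)))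
        * Zl 4 (δ / 2 / 2))) (δ / 2 / 2) := by
  have hn1 : 1 ≤ n := Nat.one_le_iff_ne_zero.2 (NeZero.ne n)
  exact vertexFamily_vertexOfK_K₀_SLam n (vertexFamily_symHessFFAt (d := 3) hn1 (ctrOff_mem_box hn1) hδ.le) hδ hδK

/-- [folklore] **`V^s := vertexOfK K₀ n S⁰` AT THE RECORD IS A VERTEX FAMILY, HYPOTHESIS-FREE, CONSTANT DISPLAYED** (`0 < δ ≤ κ′∕(4n)`; §2 over §3 `locStencil_S_zero_record`):
rate `δ∕4` — the `hV` plug for the HEAD's `G^{Dsh}` bubble cross words and for `Wmix(Λc; V_{S⁰})`. -/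
theorem vertexFamily_vertexOfK_K₀_S_zero_record (hodd : Odd n) (N : ℕ) (cM cΛ cB : ℝ) {δ : ℝ} (hδ : 0 < δ)
    (hδK : δ ≤ kappa163 4 / 4 / (4 * (n : ℝ))) :
    VertexFamily (vertexOfK (KInvStep (d := 3) n 0) n (JsB12CombSh0 hodd N (symTablesAn1S2 3 n cM) cΛ cB 0).S) n
      (4 * ((((n : ℝ) ^ 5)⁻¹ * ((MG163 4 * periodConst (kappa163 4) 3) * Real.exp (kappa163 4 / 4)))
        * (((n : ℝ) ^ 4 * (wBound 3 * Real.exp (4 * (δ / 2)))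
              + (n : ℝ) ^ 8 / 2 * (3 * (ell (3 + 1) n : ℝ) ^ 2 * Real.exp (4 * ((3 : ℝ) + 1) * n * (δ / 2))))
            + |cΛ| * (((3 + 1 : ℕ) : ℝ) * (((((n : ℝ) ^ 5)⁻¹ * ((3 : ℝ) ^ (3 + 1) * ((3 + 1 : ℕ) : ℝ) * (16 * ((3 + 1 : ℕ) : ℝ)) * (MG163 4 * periodConst (kappa163 4) 3)
                * Real.exp (kappa163 4 / 4) * Real.exp (kappa163 4 / 4) * Real.exp (kappa163 4 / 4))) * Real.exp (kappa163 4 / 4))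
              * (2 * (ell (3 + 1) n : ℝ) ^ 2 * Real.exp (4 * ((3 : ℝ) + 1) * n * δ)) * Zl (3 + 1) (δ / 2))))
        * Zl 4 (δ / 2 / 2))) (δ / 2 / 2) :=
  vertexFamily_vertexOfK_K₀ n (locStencil_S_zero_record n hodd N cM cΛ cB hδ hδK) (half_pos hδ) ((half_le_self hδ.le).trans hδK)

/-! ## §4 The record's multiplier table `tabs.M j = M1Of 3 n (symHessFFAt ρ_c n) cΛ j` -/

/-- [folklore] **`V^M := vertexOfM K₀ n (tabs.M j)` AT THE RECORD IS A VERTEX FAMILY, `(n⁵)⁻¹·(n³)⁻¹` DISPLAYED** (modulo the displayed `hΦ`, `0 < κ₀`; `0 < δ ≤ κ₀∕(4n)`;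
`(symTablesAn1S2 3 n cΛ).M j = M1Of 3 n (symHessFFAt ρ_c n) cΛ j` by `rfl`, an2's `SpineRooted.vertexFamily_M1Of` over an1's (LH) letter): rate `δ∕2`, constant
`4·((CΦ·(n⁵)⁻¹·(n³)⁻¹·e^{κ₀})·(|cΛ·wM1 3 n j|·2·ell(4,n)²·e^{16nδ})·Zl 4 (δ∕2))` — the `hV` plug for the HEAD's mixed contacts `W^{M} = Wmix(Λ; V^M)` (spec v1.1 §2 (H2-M), `j = 0`). -/
theorem vertexFamily_vertexOfM_K₀_M1Of_record {CΦ κ₀ : ℝ} (hκ₀ : 0 < κ₀)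
    (hΦ : ∀ (ρ ν : Fin (3 + 1)) (w : Fin (3 + 1) → ℤ),
      |wΦ (N := n) ρ ν w| ≤ CΦ * ((n : ℝ) ^ 5)⁻¹ * ((n : ℝ) ^ 3)⁻¹ * Real.exp (-(κ₀ * supNorm w)))
    (cΛ : ℝ) (j : ℕ) {δ : ℝ} (hδ : 0 < δ) (hδ₀ : δ ≤ κ₀ / (4 * (n : ℝ))) :
    VertexFamily (vertexOfM (KInvStep (d := 3) n 0) n ((symTablesAn1S2 3 n cΛ).M j)) n
      (4 * ((CΦ * ((n : ℝ) ^ 5)⁻¹ * ((n : ℝ) ^ 3)⁻¹ * Real.exp κ₀)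
        * (|cΛ * wM1 3 n j| * (2 * (ell (3 + 1) n : ℝ) ^ 2 * Real.exp (4 * ((3 : ℝ) + 1) * n * δ))) * Zl 4 (δ / 2))) (δ / 2) := by
  have hn1 : 1 ≤ n := Nat.one_le_iff_ne_zero.2 (NeZero.ne n)
  have hM : VertexFamily ((symTablesAn1S2 3 n cΛ).M j) n (|cΛ * wM1 3 n j| * (2 * (ell (3 + 1) n : ℝ) ^ 2 * Real.exp (4 * ((3 : ℝ) + 1) * n * δ))) δ :=
    vertexFamily_M1Of (vertexFamily_symHessFFAt (d := 3) hn1 (ctrOff_mem_box hn1) hδ.le) cΛ j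
  exact vertexFamily_vertexOfM_K₀_of_wΦ n hκ₀ hΦ hM hδ hδ₀

end Straight

end Summit.QuantumFields.BalabanUV.Beta.D1BFx.StraightPinVertexFamilies

end
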